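import Summits.AtomisticToContinuum.BoseEinsteinCondensation.Theorems.BECCutLineWeakDisorderWitnessTransferRatio
import Literature.MathematicalPhysics.QuantumManyBody.GroundStateFeynmanKacCutLine
import HarnessLib

/-!
# Route BECCutLineWeakDisorder — `WitnessTransfer`, V: the landscape witness from a
ground-state candidate (abstract transfer)

Support file (does not close the item) for item stmt-AtomisticToContinuum-14978
(`Summit.AtomisticToContinuum.BoseEinsteinCondensation.Theses.BECCutLineWeakDisorder.WitnessTransfer`,
`TwoReplicaTransienceBound → LandscapeBound`). This is the potential-independent core of the
transfer, at FIXED particle number `n + 1` and box `Λ_L`: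

* `ratio_le_of_tendsto_fkWitness` — if the finite-`T` Feynman–Kac witnesses
  `Ψ_T = fkWitness v L T 1` converge pointwise to `Ψ₀` with a bound uniform in `T ≥ 1`, then a
  bound `∫ L³ m_T²/s_T² ≤ C` for all `T ≥ 1` (the two-replica hypothesis) passes to `Ψ₀`
  (Fatou for the landscape ratio, part I);
* `tendsto_ratioIntegrand_of_unif` — the landscape integrand of a uniformly convergent,
  uniformly bounded family converges at EVERY slice (at slices of zero mass by the uniform
  bound `m ≤ η s`);
* `landscape_witness` — **the witness**: given `Ψ₀ ≥ 0` with landscape ratio `≤ C` and an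
  approximating family `g θ → Ψ₀` (`θ → 1⁺`, uniformly, uniformly bounded, supported in the box)
  whose normalised members `c · g θ` are trial states of energy `≤ E₀ + ε` for `θ` in any
  prescribed eventually-true set and any `ε > 0` (with `c² ≤ 1 + ε`), there is for every `δ > 0` a
  NONNEGATIVE trial state `Ψ` with `energy v Ψ ≤ E₀ + δ` and landscape ratio `≤ C + 1`
  (dominated convergence for the ratio, part I, and the scaling `R(cf) = c²R(f)`).

Parts III–IV discharge the hypotheses for bounded pair potentials (`Ψ₀` the Feynman–Kac ground
state of `GroundStateFeynmanKac_holds`, `g θ = trialFn L θ Ψ₀`); for `⊤`-valued (hard-core) or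
non-`L¹_loc` potentials they are the missing input (see the file of part VI).
-/

noncomputable section

open MeasureTheory Filter Set
open scoped ENNReal NNReal Topology

namespace Summit.AtomisticToContinuum.BoseEinsteinCondensation.Theorems.CutLineWitness

open Literature.MathematicalPhysics.QuantumManyBody.BoseGas

variable {n : ℕ}

/-! ### The two-replica bound passes to the limit of the witnesses -/

/-- **The landscape bound passes from the finite-`T` witnesses to their limit.** If
`Ψ_T = fkWitness v L T 1 → Ψ₀` pointwise as `T → ∞`, `Ψ_T ≤ K` for `T ≥ 1`, and
`∫ L³ m_T²/s_T² ≤ C` for all `T ≥ 1`, then `∫ L³ m_{Ψ₀}²/s_{Ψ₀}² ≤ C` (Fatou along `T = k + 1`).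
[folklore] -/
theorem ratio_le_of_tendsto_fkWitness {v : ℝ → ℝ≥0∞} (hv : Measurable v) {L : ℝ}
    {Ψ₀ : Config (n + 1) → ℝ} {K : ℝ}
    (hlim : ∀ X, Tendsto (fun T : ℝ => fkWitness v L T (fun _ => (1 : ℝ≥0∞)) X) atTop (𝓝 (Ψ₀ X)))
    (hbd : ∀ T : ℝ, 1 ≤ T → ∀ X : Config (n + 1), fkWitness v L T (fun _ => (1 : ℝ≥0∞)) X ≤ K)
    {C : ℝ≥0∞}
    (hC : ∀ T : ℝ, 1 ≤ T → ∫⁻ Y : Config n, ENNReal.ofReal (L ^ 3) *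
        (∫⁻ x, (‖fkWitness v L T (fun _ => (1 : ℝ≥0∞)) (Matrix.vecCons x Y)‖₊ : ℝ≥0∞) ^ 2) ^ 2 /
          (∫⁻ x, (‖fkWitness v L T (fun _ => (1 : ℝ≥0∞)) (Matrix.vecCons x Y)‖₊ : ℝ≥0∞)) ^ 2 ≤ C) :
    ∫⁻ Y : Config n, ENNReal.ofReal (L ^ 3) *
        (∫⁻ x, (‖Ψ₀ (Matrix.vecCons x Y)‖₊ : ℝ≥0∞) ^ 2) ^ 2 /
          (∫⁻ x, (‖Ψ₀ (Matrix.vecCons x Y)‖₊ : ℝ≥0∞)) ^ 2 ≤ C := by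
  set f : ℕ → Config (n + 1) → ℝ := fun k => fkWitness v L ((k : ℝ) + 1) fun _ => (1 : ℝ≥0∞) with hf
  have hk1 : ∀ k : ℕ, (1 : ℝ) ≤ (k : ℝ) + 1 := fun k => by
    have : (0 : ℝ) ≤ k := k.cast_nonneg
    linarith
  have hfm : ∀ k, Measurable (f k) := fun k => measurable_fkWitness hv L _ measurable_const
  have hbound : ∀ k X, |f k X| ≤ K := fun k X => by
    rw [hf, abs_of_nonneg (fkWitness_nonneg v L _ _ X)]
    exact hbd _ (hk1 k) X
  have hsupp : ∀ k X, X ∉ boxN (n + 1) L → f k X = 0 := fun k X hX =>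
    fkWitness_of_notMem v (zero_le_one.trans (hk1 k)) _ hX
  have hlim' : ∀ X, Tendsto (fun k => f k X) atTop (𝓝 (Ψ₀ X)) := fun X =>
    (hlim X).comp (tendsto_atTop_add_const_right atTop (1 : ℝ) tendsto_natCast_atTop_atTop)
  refine (lintegral_ratio_le_liminf hfm hbound hsupp hlim').trans ?_
  exact liminf_le_of_frequently_le' (Eventually.of_forall fun k => hC _ (hk1 k)).frequently

/-! ### Uniform convergence of a family and its landscape integrand -/

/-- `∫ |g|² ≤ η ∫ |g|` when `|g| ≤ η` almost everywhere. [folklore] -/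
theorem lintegral_sq_le_mul_lintegral_ae {g : Space → ℝ} {η : ℝ}
    (hg : ∀ᵐ x ∂(volume : Measure Space), |g x| ≤ η) :
    ∫⁻ x, (‖g x‖₊ : ℝ≥0∞) ^ 2 ≤ ENNReal.ofReal η * ∫⁻ x, (‖g x‖₊ : ℝ≥0∞) := by
  rw [← lintegral_const_mul' _ _ ENNReal.ofReal_ne_top]
  refine lintegral_mono_ae ?_
  filter_upwards [hg] with x hx
  rw [sq]
  exact mul_le_mul' (coe_nnnorm_le_ofReal hx) le_rfl

/-- **Convergence of the landscape integrand at every slice under uniform convergence.** If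
measurable `f_i`, `|f_i| ≤ K`, supported in `Λ_L^{n+1}`, converge to a measurable `f`
uniformly (`∀ η > 0`, eventually `|f_i - f| ≤ η` everywhere), then for every slice `Y`,
`L³ m_{f_i}(Y)²/s_{f_i}(Y)² → L³ m_f(Y)²/s_f(Y)²`: at slices with `s_f(Y) > 0` by continuity
(part I), at slices with `s_f(Y) = 0` because there `f(· :: Y) = 0` a.e., so
`|f_i(· :: Y)| ≤ η` a.e., `m_{f_i} ≤ η s_{f_i}` and the integrand is `≤ L³ η²`. [folklore] -/
theorem tendsto_ratioIntegrand_of_unif {ι : Type*} {l : Filter ι} [l.IsCountablyGenerated]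
    [l.NeBot] {L K : ℝ} {f : ι → Config (n + 1) → ℝ} {f₀ : Config (n + 1) → ℝ}
    (hfm : ∀ i, Measurable (f i)) (hf₀m : Measurable f₀) (hbound : ∀ i X, |f i X| ≤ K)
    (hsupp : ∀ i X, X ∉ boxN (n + 1) L → f i X = 0)
    (hunif : ∀ η : ℝ, 0 < η → ∀ᶠ i in l, ∀ X, |f i X - f₀ X| ≤ η) (Y : Config n) :
    Tendsto (fun i => ENNReal.ofReal (L ^ 3) *
        (∫⁻ x, (‖f i (Matrix.vecCons x Y)‖₊ : ℝ≥0∞) ^ 2) ^ 2 /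
          (∫⁻ x, (‖f i (Matrix.vecCons x Y)‖₊ : ℝ≥0∞)) ^ 2) l
      (𝓝 (ENNReal.ofReal (L ^ 3) * (∫⁻ x, (‖f₀ (Matrix.vecCons x Y)‖₊ : ℝ≥0∞) ^ 2) ^ 2 /
          (∫⁻ x, (‖f₀ (Matrix.vecCons x Y)‖₊ : ℝ≥0∞)) ^ 2)) := by
  -- pointwise convergence
  have hlim : ∀ X, Tendsto (fun i => f i X) l (𝓝 (f₀ X)) := fun X => by
    rw [Metric.tendsto_nhds]
    intro ε hε
    filter_upwards [hunif (ε / 2) (half_pos hε)] with i hi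
    rw [Real.dist_eq]
    exact (hi X).trans_lt (half_lt_self hε)
  by_cases hpos : 0 < ∫⁻ x, (‖f₀ (Matrix.vecCons x Y)‖₊ : ℝ≥0∞)
  · exact tendsto_ratioIntegrand hfm hbound hsupp hlim hpos
  -- the slice of `f₀` vanishes a.e.
  rw [not_lt, le_zero_iff] at hpos
  have hae : ∀ᵐ x ∂(volume : Measure Space), f₀ (Matrix.vecCons x Y) = 0 := by
    have h1 := (lintegral_eq_zero_iff (measurable_slice hf₀m Y).nnnorm.coe_nnreal_ennreal).1 hpos
    filter_upwards [h1] with x hx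
    simpa using hx
  have hm0 : ∫⁻ x, (‖f₀ (Matrix.vecCons x Y)‖₊ : ℝ≥0∞) ^ 2 = 0 := by
    rw [lintegral_eq_zero_iff ((measurable_slice hf₀m Y).nnnorm.coe_nnreal_ennreal.pow_const 2)]
    filter_upwards [hae] with x hx
    simp [hx]
  have hlimit : ENNReal.ofReal (L ^ 3) * (∫⁻ x, (‖f₀ (Matrix.vecCons x Y)‖₊ : ℝ≥0∞) ^ 2) ^ 2 /
      (∫⁻ x, (‖f₀ (Matrix.vecCons x Y)‖₊ : ℝ≥0∞)) ^ 2 = 0 := by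
    rw [hpos, hm0]; simp
  rw [hlimit, ENNReal.tendsto_nhds_zero]
  intro ε hε
  -- choose `η` with `L³ η² < ε`... it suffices `ofReal (L^3) * ofReal η ^ 2 ≤ ε`
  obtain ⟨η, hη, hηε⟩ : ∃ η : ℝ, 0 < η ∧ ENNReal.ofReal (L ^ 3) * ENNReal.ofReal η ^ 2 ≤ ε := by
    have ht : Tendsto (fun η : ℝ => ENNReal.ofReal (L ^ 3) * ENNReal.ofReal η ^ 2) (𝓝[>] 0) (𝓝 0) := by
      have h0 : Tendsto (fun η : ℝ => η) (𝓝[>] (0 : ℝ)) (𝓝 0) :=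
        tendsto_id.mono_left nhdsWithin_le_nhds
      have h1 : Tendsto (fun η : ℝ => ENNReal.ofReal η) (𝓝[>] (0 : ℝ)) (𝓝 0) := by
        simpa using ENNReal.tendsto_ofReal h0
      have h2 := ENNReal.Tendsto.const_mul (ENNReal.Tendsto.pow (n := 2) h1)
        (Or.inr ENNReal.ofReal_ne_top) (a := ENNReal.ofReal (L ^ 3))
      simpa using h2
    obtain ⟨η, hηε, hη⟩ := ((ht.eventually (ge_mem_nhds hε)).and self_mem_nhdsWithin).exists
    exact ⟨η, hη, hηε⟩
  filter_upwards [hunif η hη] with i hi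
  have hbd : ∀ᵐ x ∂(volume : Measure Space), |f i (Matrix.vecCons x Y)| ≤ η := by
    filter_upwards [hae] with x hx
    have := hi (Matrix.vecCons x Y)
    rwa [hx, sub_zero] at this
  exact (mul_sq_div_sq_le (lintegral_sq_le_mul_lintegral_ae hbd)).trans hηε

/-! ### The landscape witness -/

/-- Elementary: `c² (C + 1/2) ≤ C + 1` when `c² ≤ 1 + ε`, `ε (2C + 1) ≤ 1`, `C ≥ 0`.
[folklore] -/
theorem sq_mul_add_half_le {a ε C : ℝ} (hC : 0 ≤ C) (ha : a ≤ 1 + ε)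
    (hεC : ε * (2 * C + 1) ≤ 1) : a * (C + 1 / 2) ≤ C + 1 := by
  nlinarith

/-- **The landscape witness at fixed `N = n + 1` and `L`.** Let `Ψ₀ : (ℝ³)^{n+1} → ℝ` be
measurable with landscape ratio `∫ L³ m_{Ψ₀}²/s_{Ψ₀}² ≤ C` (`0 ≤ C < ∞`), and let `g θ` (`θ > 1`)
be measurable real functions, uniformly bounded, supported in `Λ_L^{n+1}`, nonnegative, with
`g θ → Ψ₀` uniformly as `θ → 1⁺`, such that for every property `P` of `θ` holding eventually as
`θ → 1⁺` and every `ε > 0` some `θ` with `P θ` carries a trial state `Ψ` with wave function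
`c · g θ`, `0 < c`, `c² ≤ 1 + ε`, and `energy v Ψ ≤ E₀ + ε`. Then for every `δ > 0` there is a
NONNEGATIVE trial state `Ψ ∈ TrialState (n+1) L` with `energy v Ψ ≤ E₀ + δ` and landscape ratio
`≤ C + 1`. [folklore] -/
theorem landscape_witness {L : ℝ} {v : ℝ → ℝ≥0∞} {E₀ : ℝ≥0∞} {Ψ₀ : Config (n + 1) → ℝ}
    (hΨm : Measurable Ψ₀) {C : ℝ} (hC0 : 0 ≤ C)
    (hC : ∫⁻ Y : Config n, ENNReal.ofReal (L ^ 3) *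
        (∫⁻ x, (‖Ψ₀ (Matrix.vecCons x Y)‖₊ : ℝ≥0∞) ^ 2) ^ 2 /
          (∫⁻ x, (‖Ψ₀ (Matrix.vecCons x Y)‖₊ : ℝ≥0∞)) ^ 2 ≤ ENNReal.ofReal C)
    {g : ℝ → Config (n + 1) → ℝ} {K : ℝ} (hgm : ∀ θ, Measurable (g θ))
    (hgb : ∀ θ X, |g θ X| ≤ K) (hgs : ∀ θ X, X ∉ boxN (n + 1) L → g θ X = 0)
    (hg0 : ∀ θ X, 0 ≤ g θ X)
    (hunif : ∀ η : ℝ, 0 < η → ∀ᶠ θ in 𝓝[>] (1 : ℝ), ∀ X, |g θ X - Ψ₀ X| ≤ η)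
    (happrox : ∀ P : ℝ → Prop, (∀ᶠ θ in 𝓝[>] (1 : ℝ), P θ) → ∀ ε : ℝ≥0, 0 < ε →
      ∃ (θ : ℝ) (c : ℝ) (Ψ : TrialState (n + 1) L), P θ ∧ 0 < c ∧ c ^ 2 ≤ 1 + ε ∧
        (Ψ.ψ = fun X => (((c * g θ X : ℝ)) : ℂ)) ∧ energy v Ψ ≤ E₀ + ε)
    {δ : ℝ≥0∞} (hδ : 0 < δ) :
    ∃ Ψ : TrialState (n + 1) L, energy v Ψ ≤ E₀ + δ ∧ (∀ X, Ψ.ψ X = (‖Ψ.ψ X‖ : ℂ)) ∧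
      ∫⁻ Y : Config n, ENNReal.ofReal (L ^ 3) *
        (∫⁻ x, (‖Ψ.ψ (Matrix.vecCons x Y)‖₊ : ℝ≥0∞) ^ 2) ^ 2 /
          (∫⁻ x, (‖Ψ.ψ (Matrix.vecCons x Y)‖₊ : ℝ≥0∞)) ^ 2 ≤ ENNReal.ofReal (C + 1) := by
  -- the ratio of `g θ` tends to that of `Ψ₀`, hence is eventually `≤ C + 1/2`
  have hI := fun Y : Config n => tendsto_ratioIntegrand_of_unif (l := 𝓝[>] (1 : ℝ))
    hgm hΨm hgb hgs hunif Y
  have hR := tendsto_lintegral_ratio (l := 𝓝[>] (1 : ℝ)) hgm hgb hgs (Eventually.of_forall hI)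
  have hlt : ENNReal.ofReal C < ENNReal.ofReal (C + 1 / 2) :=
    (ENNReal.ofReal_lt_ofReal_iff (by linarith)).2 (by linarith)
  have hP : ∀ᶠ θ in 𝓝[>] (1 : ℝ), ∫⁻ Y : Config n, ENNReal.ofReal (L ^ 3) *
      (∫⁻ x, (‖g θ (Matrix.vecCons x Y)‖₊ : ℝ≥0∞) ^ 2) ^ 2 /
        (∫⁻ x, (‖g θ (Matrix.vecCons x Y)‖₊ : ℝ≥0∞)) ^ 2 ≤ ENNReal.ofReal (C + 1 / 2) :=
    (hR.eventually (gt_mem_nhds (hC.trans_lt hlt))).mono fun θ hθ => hθ.le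
  -- choose `ε ≤ δ` with `ε (2C + 1) ≤ 1`
  obtain ⟨ε₁, hε₁0, hε₁δ⟩ := ENNReal.lt_iff_exists_nnreal_btwn.1 hδ
  have hden : (0 : ℝ) < 2 * C + 1 := by linarith
  set ε₂ : ℝ≥0 := ⟨1 / (2 * C + 1), by positivity⟩ with hε₂
  have hε₂0 : 0 < ε₂ := by
    rw [hε₂, ← NNReal.coe_pos]
    exact div_pos one_pos hden
  set ε : ℝ≥0 := min ε₁ ε₂ with hεdef
  have hε0 : 0 < ε := lt_min (by exact_mod_cast hε₁0) hε₂0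
  have hεC : (ε : ℝ) * (2 * C + 1) ≤ 1 := by
    have h1 : (ε : ℝ) ≤ ε₂ := by exact_mod_cast min_le_right ε₁ ε₂
    have h2 : ((ε₂ : ℝ≥0) : ℝ) = 1 / (2 * C + 1) := by rw [hε₂]; rfl
    rw [h2] at h1
    exact (le_div_iff₀ hden).1 h1
  obtain ⟨θ, c, Ψ, hPθ, hc0, hc2, hψ, hE⟩ := happrox _ hP ε hε0
  have hψX : ∀ X, Ψ.ψ X = (((c * g θ X : ℝ)) : ℂ) := fun X => by rw [hψ]
  refine ⟨Ψ, ?_, ?_, ?_⟩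
  · -- energy
    calc energy v Ψ ≤ E₀ + ε := hE
      _ ≤ E₀ + δ := by
          gcongr
          calc (ε : ℝ≥0∞) ≤ ε₁ := by exact_mod_cast min_le_left _ _
            _ ≤ δ := hε₁δ.le
  · -- nonnegativity
    intro X
    rw [hψX X]
    have h0 : 0 ≤ c * g θ X := mul_nonneg hc0.le (hg0 θ X)
    rw [Complex.norm_real, Real.norm_of_nonneg h0]
  · -- the ratio
    have hratio : ∫⁻ Y : Config n, ENNReal.ofReal (L ^ 3) *
        (∫⁻ x, (‖Ψ.ψ (Matrix.vecCons x Y)‖₊ : ℝ≥0∞) ^ 2) ^ 2 /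
          (∫⁻ x, (‖Ψ.ψ (Matrix.vecCons x Y)‖₊ : ℝ≥0∞)) ^ 2 =
        ENNReal.ofReal (c ^ 2) * ∫⁻ Y : Config n, ENNReal.ofReal (L ^ 3) *
          (∫⁻ x, (‖g θ (Matrix.vecCons x Y)‖₊ : ℝ≥0∞) ^ 2) ^ 2 /
            (∫⁻ x, (‖g θ (Matrix.vecCons x Y)‖₊ : ℝ≥0∞)) ^ 2 := by
      rw [← lintegral_ratio_const_mul L (g θ) hc0.ne']
      simp_rw [hψX, Complex.nnnorm_real]
    rw [hratio]
    have hc2' : c ^ 2 ≤ 1 + (ε : ℝ) := by exact_mod_cast hc2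
    calc ENNReal.ofReal (c ^ 2) * ∫⁻ Y : Config n, ENNReal.ofReal (L ^ 3) *
          (∫⁻ x, (‖g θ (Matrix.vecCons x Y)‖₊ : ℝ≥0∞) ^ 2) ^ 2 /
            (∫⁻ x, (‖g θ (Matrix.vecCons x Y)‖₊ : ℝ≥0∞)) ^ 2
        ≤ ENNReal.ofReal (c ^ 2) * ENNReal.ofReal (C + 1 / 2) := mul_le_mul' le_rfl hPθ
      _ = ENNReal.ofReal (c ^ 2 * (C + 1 / 2)) := (ENNReal.ofReal_mul (sq_nonneg c)).symm
      _ ≤ ENNReal.ofReal (C + 1) :=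
          ENNReal.ofReal_le_ofReal (sq_mul_add_half_le hC0 hc2' hεC)

end Summit.AtomisticToContinuum.BoseEinsteinCondensation.Theorems.CutLineWitness

end
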